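import Literature.AlgebraicGeometry.Limits.RatFnLimitDescent
import HarnessLib

/-!
# Rational functions on a limit of integral schemes with affine transition maps
# (The Stacks Project, Tag 01YT; Görtz–Wedhorn I, (10.13))

Topic: `Literature/AlgebraicGeometry/Limits`. Let `c.pt = lim_i D i` be a limit of a cofiltered
diagram of integral schemes with affine transition maps, `c.pt` integral and the projections
`π_i : c.pt → D i` and transition maps dominant (the setting of noetherian approximation, The
Stacks Project, Section 01YT; Görtz–Wedhorn I, (10.13), Thm. 10.57, Thm. 10.60: `S = lim S_λ` for
`A = colim A_λ`; in this tree `Limits/SubalgebraDiagram`, `Limits/FieldExtensionDiagram`). Mathlib's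
`Mathlib/AlgebraicGeometry/AffineTransitionLimit` proves that quasi-compact opens and sections of
the structure sheaf descend along such limits. This file adds the statements about RATIONAL
FUNCTIONS (`RatFn`, `Motives/CartierDivisor`) that the descent of Cartier divisors and of their
linear-equivalence classes along such limits consumes (towards `theoremOfCube_noetherianDescent`
of `Motives/TheoremOfCubeLimit` and `cartierDivisor_prod_noetherianDescent` of
`Motives/GrothendieckComplexFieldPoints`):

* `exists_functionFieldMap_π_eq` — **`K(lim D i) = ⋃_i π_i^♯ K(D i)`**: every rational function on
  the limit is the pullback of a rational function on some stage (a germ at the generic point is a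
  section over a basic open `π_i⁻¹V`, `V ⊆ D i` affine, Mathlib `isBasis_preimage_isAffineOpen`, and
  `Γ(π_i⁻¹V, 𝒪) = colim_{j → i} Γ((D j_i)⁻¹V, 𝒪)`, Mathlib
  `exists_appTop_π_eq_of_isAffine_of_isLimit` on the opens cone `isLimitOpensCone`; The Stacks
  Project, Lemma 01Z0 (1) for `𝒪`);
* `exists_forall_isRegularAt_functionFieldMap` — **regular functions descend**: if `π_i^♯ h` is
  regular at every point of `π_i⁻¹U`, `U ⊆ D i` a quasi-compact open, then `(D f)^♯ h` is regular
  at every point of `(D f)⁻¹U` for some `f : j → i` (the section `π_i^♯ h ∈ Γ(π_i⁻¹U, 𝒪)`,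
  Görtz–Wedhorn I, Prop. 3.29 (3), descends to some `Γ((D f)⁻¹U, 𝒪)` by Mathlib
  `exists_appTop_π_eq_of_isLimit`, and has the rational function `(D f)^♯ h` since `π_j^♯` is
  injective);
* `exists_forall_isUnitAt_functionFieldMap` — **units descend**: the same with "unit of the local
  ring" (apply the previous statement to `h` and then to `h⁻¹` one stage further down).

Generality: an ARBITRARY cofiltered diagram and limit cone (hypotheses: integral stages and
limit, dominant projections and transition maps), so that the statements apply at once to the
three kinds of cones of this topic — `SubalgApprox.prodCone`
(`(P ⊗ Spec B).left = lim (P ⊗ Spec K[t]).left`, `Limits/SubalgebraDiagram`), `FieldExt.schemeCone`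
(`Y_K = lim Y_{k(t)}`, `Limits/FieldExtensionDiagram`) and Mathlib's opens cones `opensCone` over
either. `Limits/RatFnLimitDescent` (same day) proves the first and third statement for
`SubalgApprox.prodCone` specifically (`SubalgApprox.exists_functionFieldMap_eq`,
`SubalgApprox.exists_forall_isUnitAt_functionFieldMap_of_isCompact`); refactor: those are the
special cases `D = prodDiagram`, `c = prodCone` of the statements here (we reuse its
`SubalgApprox.functionFieldMap_congr`). The dictionary between
rational functions and sections is the tree's (`RatFn.ofSection`,
`RatFn.exists_germ_eq_of_forall_isRegularAt` — `Γ(U, 𝒪) = ⋂_{x ∈ U} 𝒪_{X,x}`, Görtz–Wedhorn I,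
Prop. 3.29 (3) —, `RatFn.functionFieldMap_ofSection`). Mathlib searched (pin): `opensCone`,
`isLimitOpensCone`, `isBasis_preimage_isAffineOpen`, `exists_appTop_π_eq_of_isLimit`,
`exists_appTop_π_eq_of_isAffine_of_isLimit`, `Scheme.Hom.resLE_app_top`,
`QuasiSeparatedSpace.of_isOpenEmbedding` (used); Mathlib has no function-field statements for
limits.

## References

* The Stacks Project, Tag 01YT (Limits of schemes), Lemmas 01Z0, 01Z4. [StacksProject]
* U. Görtz, T. Wedhorn, *Algebraic Geometry I: Schemes*, 2nd ed. (2020): (10.13) and Thm. 10.57,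
  pp. 321–325; Prop. 3.29, p. 102 (read via the held copy). [GortzWedhorn2020]
-/

universe u

open CategoryTheory CategoryTheory.Limits AlgebraicGeometry TopologicalSpace Opposite
open Literature.AlgebraicGeometry.Motives Literature.AlgebraicGeometry.Motives.RatFn

noncomputable section

namespace Literature.AlgebraicGeometry.Limits

set_option backward.isDefEq.respectTransparency false

variable {I : Type u} [Category.{u} I] [IsCofiltered I] (D : I ⥤ Scheme.{u}) (c : Cone D)
  (hc : IsLimit c) [∀ {i j : I} (f : i ⟶ j), IsAffineHom (D.map f)]

/-! ### Bookkeeping -/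

omit [IsCofiltered I] [∀ {i j : I} (f : i ⟶ j), IsAffineHom (D.map f)] in
/-- The projection `π_i : c.pt → D i` of a cone, with source displayed as `c.pt` (Mathlib's
`c.π.app i` has source `((Functor.const I).obj c.pt).obj i`, which instance search does not unfold).
[folklore] -/
abbrev proj (i : I) : c.pt ⟶ D.obj i := c.π.app i

omit [IsCofiltered I] [∀ {i j : I} (f : i ⟶ j), IsAffineHom (D.map f)] in
/-- The cone identity `π_j ≫ D f = π_i` for `proj`. [folklore] -/
@[simp] theorem proj_comp {i j : I} (f : j ⟶ i) : proj D c j ≫ D.map f = proj D c i := c.w f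

omit [IsCofiltered I] [∀ {i j : I} (f : i ⟶ j), IsAffineHom (D.map f)] in
/-- The projection `π_i⁻¹V → (D j_i)⁻¹V` of the opens cone (Mathlib `opensCone`) on global sections
is `π_j^*` followed by the restriction from `π_j⁻¹(D j_i)⁻¹V` to `π_i⁻¹V` (Mathlib
`Scheme.Hom.resLE_app_top`). [folklore] -/
theorem topIso_hom_opensCone_π_appTop (i : I) (V : (D.obj i).Opens) (j : Over i)
    (t : Γ(D.map j.hom ⁻¹ᵁ V, ⊤)) :
    (proj D c i ⁻¹ᵁ V).topIso.hom (((opensCone D c i V).π.app j).appTop t) =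
      (proj D c j.left).appLE (D.map j.hom ⁻¹ᵁ V) (proj D c i ⁻¹ᵁ V)
        (by rw [← Scheme.Hom.comp_preimage, proj_comp]) ((D.map j.hom ⁻¹ᵁ V).topIso.hom t) := by
  have e : proj D c i ⁻¹ᵁ V ≤ proj D c j.left ⁻¹ᵁ D.map j.hom ⁻¹ᵁ V := by
    rw [← Scheme.Hom.comp_preimage, proj_comp]
  have h1 : ((opensCone D c i V).π.app j).appTop =
      ((proj D c j.left).resLE (D.map j.hom ⁻¹ᵁ V) (proj D c i ⁻¹ᵁ V) e).app ⊤ := rfl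
  rw [h1, Scheme.Hom.resLE_app_top]
  simp only [CommRingCat.comp_apply]
  exact Iso.inv_hom_id_apply _ _

variable [∀ i, IsIntegral (D.obj i)] [IsIntegral c.pt] [∀ i, IsDominant (proj D c i)]

/-! ### Rational functions on the limit come from a stage -/

include hc in
/-- **`K(lim_i D i) = ⋃_i π_i^♯ K(D i)`**: every rational function on the limit of a cofiltered
diagram of integral schemes with affine transition maps and dominant projections is the pullback
of a rational function on some stage (The Stacks Project, Lemma 01Z0 (1), for the section
representing it on a basic open `π_i⁻¹V`, `V` affine; Görtz–Wedhorn I, Thm. 10.57). [folklore] -/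
theorem exists_functionFieldMap_π_eq (h : c.pt.functionField) :
    ∃ (i : I) (h' : (D.obj i).functionField), functionFieldMap (proj D c i) h' = h := by
  obtain ⟨U, hηU, s, hs⟩ := TopCat.Presheaf.exists_germ_eq c.pt.presheaf (x := genericPoint c.pt) h
  obtain ⟨_, ⟨W, hWB, rfl⟩, hηW, hWU⟩ :=
    (isBasis_preimage_isAffineOpen D c hc).exists_subset_of_mem_open hηU U.isOpen
  obtain ⟨i, V, hV, rfl⟩ := hWB
  replace hWU : proj D c i ⁻¹ᵁ V ≤ U := hWU
  replace hηW : genericPoint c.pt ∈ proj D c i ⁻¹ᵁ V := hηW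
  have hA : ∀ j : Over i, IsAffine ((opensDiagram D i V).obj j) := fun j => hV.preimage (D.map _)
  -- the section representing `h` on `π_i⁻¹V` descends to some `(D j_i)⁻¹V`
  set s' : Γ(c.pt, proj D c i ⁻¹ᵁ V) := c.pt.presheaf.map (homOfLE hWU).op s with hs'
  obtain ⟨j, t, ht⟩ := exists_appTop_π_eq_of_isAffine_of_isLimit (opensDiagram D i V)
    (opensCone D c i V) (isLimitOpensCone D c hc i V) ((proj D c i ⁻¹ᵁ V).topIso.inv s')
  have e : proj D c i ⁻¹ᵁ V ≤ proj D c j.left ⁻¹ᵁ D.map j.hom ⁻¹ᵁ V := by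
    rw [← Scheme.Hom.comp_preimage, proj_comp]
  have hηj : genericPoint (D.obj j.left) ∈ D.map j.hom ⁻¹ᵁ V := by
    have h1 : (proj D c j.left) (genericPoint c.pt) ∈ D.map j.hom ⁻¹ᵁ V := e hηW
    rwa [genericPoint_eq_of_isDominant] at h1
  refine ⟨j.left, ofSection hηj ((D.map j.hom ⁻¹ᵁ V).topIso.hom t), ?_⟩
  have key : s' = (proj D c j.left).appLE _ _ e ((D.map j.hom ⁻¹ᵁ V).topIso.hom t) := by
    have h1 := congrArg (proj D c i ⁻¹ᵁ V).topIso.hom ht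
    rw [topIso_hom_opensCone_π_appTop] at h1
    exact (Iso.inv_hom_id_apply _ _).symm.trans h1.symm
  have hs'' : ofSection hηW s' = h := by rw [hs', ofSection_map]; exact hs
  rw [functionFieldMap_ofSection, ← hs'', key, Scheme.Hom.appLE, CommRingCat.comp_apply]
  exact (ofSection_map (homOfLE e) hηW _).symm

/-! ### Regular functions and units descend -/

variable [∀ {i j : I} (f : i ⟶ j), IsDominant (D.map f)] [∀ i, QuasiSeparatedSpace (D.obj i)]

include hc in
/-- **Regular functions descend**: if `π_i^♯ h` is regular at every point of `π_i⁻¹U` for a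
non-empty quasi-compact open `U ⊆ D i`, then `(D f)^♯ h` is regular at every point of `(D f)⁻¹U`
for some `f : j → i` — the section `π_i^♯ h ∈ Γ(π_i⁻¹U, 𝒪)` (Görtz–Wedhorn I, Prop. 3.29 (3))
descends to some `Γ((D f)⁻¹U, 𝒪)` (The Stacks Project, Lemma 01Z0 (1); Görtz–Wedhorn I,
Thm. 10.57), and the descended section has the rational function `(D f)^♯ h` because `π_j^♯` is
injective. [folklore] -/
theorem exists_forall_isRegularAt_functionFieldMap {i : I} {U : (D.obj i).Opens}
    (hU : IsCompact (U : Set (D.obj i))) (hUne : (U : Set (D.obj i)).Nonempty)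
    {h : (D.obj i).functionField}
    (hh : ∀ w ∈ proj D c i ⁻¹ᵁ U, IsRegularAt w (functionFieldMap (proj D c i) h)) :
    ∃ (j : I) (f : j ⟶ i), ∀ w ∈ D.map f ⁻¹ᵁ U, IsRegularAt w (functionFieldMap (D.map f) h) := by
  have hηU : genericPoint (D.obj i) ∈ U := genericPoint_mem_of_mem hUne.some_mem
  have hη : genericPoint c.pt ∈ proj D c i ⁻¹ᵁ U := genericPoint_mem_preimage (proj D c i) hηU
  -- the section of `π_i^♯ h` over `π_i⁻¹U`
  obtain ⟨s, hs⟩ := exists_germ_eq_of_forall_isRegularAt hη hh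
  -- the opens cone over `U` has quasi-compact quasi-separated pieces, so `s` descends
  have hcpt : ∀ j : Over i, CompactSpace ((opensDiagram D i U).obj j) := fun j =>
    isCompact_iff_compactSpace.mp (QuasiCompact.isCompact_preimage (f := D.map j.hom) _ U.2 hU)
  have hqs : ∀ j : Over i, QuasiSeparatedSpace ((opensDiagram D i U).obj j) := fun j =>
    QuasiSeparatedSpace.of_isOpenEmbedding (D.map j.hom ⁻¹ᵁ U).ι.isOpenEmbedding
  obtain ⟨j, t, ht⟩ := exists_appTop_π_eq_of_isLimit (opensDiagram D i U) (opensCone D c i U)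
    (isLimitOpensCone D c hc i U) ((proj D c i ⁻¹ᵁ U).topIso.inv s)
  have e : proj D c i ⁻¹ᵁ U ≤ proj D c j.left ⁻¹ᵁ D.map j.hom ⁻¹ᵁ U := by
    rw [← Scheme.Hom.comp_preimage, proj_comp]
  have hηj : genericPoint (D.obj j.left) ∈ D.map j.hom ⁻¹ᵁ U := by
    have h1 : (proj D c j.left) (genericPoint c.pt) ∈ D.map j.hom ⁻¹ᵁ U := e hη
    rwa [genericPoint_eq_of_isDominant] at h1
  have key : s = (proj D c j.left).appLE _ _ e ((D.map j.hom ⁻¹ᵁ U).topIso.hom t) := by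
    have h1 := congrArg (proj D c i ⁻¹ᵁ U).topIso.hom ht
    rw [topIso_hom_opensCone_π_appTop] at h1
    exact ((Iso.inv_hom_id_apply _ _).symm.trans h1)
  -- `(D j_i)^♯ h` is the rational function of the descended section
  have hrat : functionFieldMap (D.map j.hom) h =
      ofSection hηj ((D.map j.hom ⁻¹ᵁ U).topIso.hom t) := by
    apply (functionFieldMap (proj D c j.left)).injective
    rw [functionFieldMap_ofSection, ← RingHom.comp_apply, ← functionFieldMap_comp,
      SubalgApprox.functionFieldMap_congr (proj_comp D c j.hom), ← hs, key, Scheme.Hom.appLE,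
      CommRingCat.comp_apply]
    exact ofSection_map (homOfLE e) hη _
  refine ⟨j.left, j.hom, fun w hw => ?_⟩
  rw [hrat]
  exact isRegularAt_ofSection hw _

include hc in
/-- **Units descend**: if `π_i^♯ h` is a unit of the local ring at every point of `π_i⁻¹U` for a
non-empty quasi-compact open `U ⊆ D i`, then `(D f)^♯ h` is a unit at every point of `(D f)⁻¹U`
for some `f : j → i` (descend the regularity of `h` to a stage `j₁`, then that of `h⁻¹` from `j₁`
to a stage `j₂`; a rational function regular together with its inverse is a unit,
`RatFn.isUnitAt_iff`).
This is the divisor-theoretic content of "isomorphisms of invertible modules descend" (The Stacks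
Project, Lemma 01ZR (2), (3); Görtz–Wedhorn I, Exercise 10.32 (b)). [folklore] -/
theorem exists_forall_isUnitAt_functionFieldMap {i : I} {U : (D.obj i).Opens}
    (hU : IsCompact (U : Set (D.obj i))) (hUne : (U : Set (D.obj i)).Nonempty)
    {h : (D.obj i).functionField}
    (hh : ∀ w ∈ proj D c i ⁻¹ᵁ U, IsUnitAt w (functionFieldMap (proj D c i) h)) :
    ∃ (j : I) (f : j ⟶ i), ∀ w ∈ D.map f ⁻¹ᵁ U, IsUnitAt w (functionFieldMap (D.map f) h) := by
  have hηU : genericPoint (D.obj i) ∈ U := genericPoint_mem_of_mem hUne.some_mem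
  have hη : genericPoint c.pt ∈ proj D c i ⁻¹ᵁ U := genericPoint_mem_preimage (proj D c i) hηU
  have h0 : h ≠ 0 := fun h0 => (hh _ hη).ne_zero (by rw [h0, map_zero])
  -- regularity of `h` descends to a stage `j₁`
  obtain ⟨j₁, f₁, hreg₁⟩ := exists_forall_isRegularAt_functionFieldMap D c hc hU hUne
    (fun w hw => (hh w hw).isRegularAt)
  -- regularity of `h⁻¹` descends from `j₁` to a stage `j₂`
  have hU₁ : IsCompact ((D.map f₁ ⁻¹ᵁ U : (D.obj j₁).Opens) : Set (D.obj j₁)) :=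
    QuasiCompact.isCompact_preimage (f := D.map f₁) _ U.2 hU
  have hU₁ne : ((D.map f₁ ⁻¹ᵁ U : (D.obj j₁).Opens) : Set (D.obj j₁)).Nonempty :=
    ⟨_, genericPoint_mem_preimage (D.map f₁) hηU⟩
  have hh' : ∀ w ∈ proj D c j₁ ⁻¹ᵁ D.map f₁ ⁻¹ᵁ U,
      IsRegularAt w (functionFieldMap (proj D c j₁) (functionFieldMap (D.map f₁) h)⁻¹) := by
    intro w hw
    rw [← map_inv₀, ← RingHom.comp_apply, ← functionFieldMap_comp,
      SubalgApprox.functionFieldMap_congr (proj_comp D c f₁)]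
    rw [← Scheme.Hom.comp_preimage, proj_comp] at hw
    rw [map_inv₀]
    exact (hh w hw).inv.isRegularAt
  obtain ⟨j₂, f₂, hreg₂⟩ := exists_forall_isRegularAt_functionFieldMap D c hc hU₁ hU₁ne hh'
  refine ⟨j₂, f₂ ≫ f₁, fun w hw => ?_⟩
  rw [D.map_comp, Scheme.Hom.comp_preimage] at hw
  rw [isUnitAt_iff, SubalgApprox.functionFieldMap_congr (D.map_comp f₂ f₁), functionFieldMap_comp,
    RingHom.comp_apply]
  refine ⟨by simpa using h0, (hreg₁ _ hw).functionFieldMap, ?_⟩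
  rw [← map_inv₀]
  exact hreg₂ w hw

end Literature.AlgebraicGeometry.Limits

end
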